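import Summits.BirchSwinnertonDyer.BirchSwinnertonDyer.Theorems.PrintCf2RamifiedOffTYZMoverBlockCharacterSix
import HarnessLib

/-!
# Crux `PrintCf2.RamifiedOffTYZOfFacts` (stmt-BirchSwinnertonDyer-20509), line `offtyz-v7`, LEAD cycle 9 (cruxlead-20509 g8):
# THE BLOCK FORM ON A BLOCK `d ≡ 6 (mod 8)` (sequel of `…MoverBlockCharacterSix`: the character `χ_d` and the Frobenius rows)

THEOREMS ONLY (no `def`, no named fact, no `sorry`), `--supports stmt-BirchSwinnertonDyer-20509`; step (E2′) of the even mover programme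
(crux workfile `Lines/offtyz_v7_SevenSector.md` §9).  With `χ_d(g) := [(g·g)^{g(d)} σ⁻¹ ∈ Gal(ℍ′_n/H′_d)]` additive on `Gal(ℍ′_n/K_d)`, killing the
`L_d(i)`-trivial elements and the involutions, `χ_d(θ) = [g(d) odd]` (previous file), and the bit vector of the Frobenius element `φ_j` equal to the
`j`-th row of `N_d = [[A_d + D₋₂, z_d],[0,0]]` (previous file):
* §3 **THE BLOCK FORM, `d ≡ 6 (mod 8)`** (`sqMotion_eq_kerSum_dotProduct_bits_six`): if `g(d)` is ODD and `#ker N_d = 2` (the genus regime) then for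
  every `g ∈ Gal(ℍ′_n/K_d)`:  `χ_d(g) = Σ_c (kerSum N_d)_c · x_c(g)`, `x(g) = ([g moves i√−q_i])_i ; [g moves i√−2])` — `χ_d` factors through the bits
  (bits `0` ⟹ trivial on `L_d(i)`), the induced additive `δ` kills the rows of `N_d`, so `δ ∈ {0, kerSum N_d ·}`, and `δ ≠ 0` because `χ_d(θ) = 1`.
* §4 `galPt_mul_self_Z_eq_add_kerSum_six`: `g·g·Z(d) = Z(d) + (kerSum N_d · x(g))·τ(1)` (with the unified block law `galPt_mul_self_Z_eq_add_ite_all`).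
The conductor-`4` Frobenius clause (F1)–(F3) is the hypothesis `hFrob` (a printed sentence, TYZ Prop. 3.2 (2) with Cox Lemma 5.19 / (5.22) / §9.A,
pending its display next to `FrobeniusTwoBlockSpec`).  BSD is not proved by any of this; no class is closed by this file.

References: [cite: TianYuanZhang2017, §3.1 (p0011 L1–L13, L53–L64), Prop. 3.2 (2) (p0010 L111–L113), Thm. 3.6 (2) (p0012 L31–L33), proof of Lemma 3.21
(p0020 L50–L63)]; [cite: Cox2013, §5.C Lemma 5.19 and (5.22), §9.A (pp. 180–181)]; [cite: HeathBrown1994SelmerCongruentII, Appendix (Monsky), typescript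
p. 41 L20–L36]; crux notes `Lines/offtyz_v7_SevenSector.md` §9.
-/

noncomputable section

open scoped Classical NumberField

open WeierstrassCurve WeierstrassCurve.Affine Finset Matrix Literature.NumberTheory.EllipticCurves
  Literature.NumberTheory.EllipticCurves.TianYuanZhang2017
  Literature.NumberTheory.EllipticCurves.TianYuanZhang2017.W2
  Literature.NumberTheory.EllipticCurves.HeathBrown1994
  Literature.NumberTheory.EllipticCurves.HeathBrown1994.Families
  Literature.NumberTheory.EllipticCurves.Smith2016
  Summit.BirchSwinnertonDyer.Rank1Residual.P2.GenusPeriodTransferLayer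
  Summit.BirchSwinnertonDyer.PrintCf2.QForm

set_option autoImplicit false

namespace Summit.BirchSwinnertonDyer.PrintCf2.MoverAssembly

variable {n : ℕ} (D : GenusPointData n)

variable {m : ℕ} (q : Fin m → ℕ) (hq : ∀ j, (q j).Prime) (hqodd : ∀ j, Odd (q j)) (hqinj : Function.Injective q)

/-! ## §3 The block form on a block `d ≡ 6 (mod 8)` -/

/-- **An additive `δ` vanishing on every ROW of a square matrix `N` over `𝔽₂` with `ker N = {0, λ}` is `0` or `v ↦ λ·v`** (any finite index type;
g7's `addMonoidHom_eq_zero_or_eq_dotProduct` for `Fin k`). [folklore] -/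
theorem addMonoidHom_eq_zero_or_eq_dotProduct' {ι : Type*} [Fintype ι] [DecidableEq ι] (N : Matrix ι ι (ZMod 2)) {v₀ : ι → ZMod 2}
    (hker : ∀ w, N *ᵥ w = 0 ↔ w = 0 ∨ w = v₀) (δ : (ι → ZMod 2) →+ ZMod 2) (hrows : ∀ j, δ (N j) = 0) :
    (∀ v, δ v = 0) ∨ (∀ v, δ v = v₀ ⬝ᵥ v) := by
  set μ : ι → ZMod 2 := fun i => δ (Pi.single i 1) with hμ
  have hδ : ∀ v, δ v = μ ⬝ᵥ v := by
    intro v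
    conv_lhs => rw [show v = ∑ i, Pi.single i (v i) from (Finset.univ_sum_single v).symm]
    rw [map_sum, dotProduct]
    refine Finset.sum_congr rfl fun i _ => ?_
    have hval : ∀ x : ZMod 2, x = 0 ∨ x = 1 := by decide
    rcases hval (v i) with h | h
    · rw [h, Pi.single_zero, map_zero, mul_zero]
    · rw [h, mul_one]
  have hNμ : N *ᵥ μ = 0 := by
    funext j
    rw [Pi.zero_apply, ← hrows j, hδ]
    simp only [mulVec, dotProduct]
    exact Finset.sum_congr rfl fun i _ => mul_comm _ _
  rcases (hker μ).mp hNμ with h | h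
  · left; intro v; rw [hδ, h, zero_dotProduct]
  · right; intro v; rw [hδ, h]

include hq hqodd hqinj in
/-- **THE BLOCK FORM ON A BLOCK `d ≡ 6 (mod 8)`.**  For a block `d = 2·q₁⋯q_m` of a square-free `n` with its CM-point display (`CMBlockSpec`), an element
`θ` fixing `√−d` with `θθσ⁻¹ ∈ Gal(ℍ′_n/H′_d)` (`ThetaBlockSpec`), the conductor-`4` Frobenius clause (hypothesis `hFrob`: (F1)–(F3) for every `q_j`), `g(d)` ODD,
and `#ker N_d = 2` (`N_d = [[A_d + D₋₂, z_d],[0,0]]` on `Fin m ⊕ Unit`) — the GENUS REGIME — every `g ∈ Gal(ℍ′_n/K_d)` satisfies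
`[(g·g)^{g(d)}·σ⁻¹ ∈ Gal(ℍ′_n/H′_d)] = Σ_c (kerSum N_d)_c · x_c(g)`, `x(g) = ([g moves i√−q_i])_i ; [g moves i√−2])`.
[cite: TianYuanZhang2017, §3.1 (p0011 L1–L13, L53–L64), Prop. 3.2 (2), Thm. 3.6 (2), proof of Lemma 3.21 (p0020 L50–L63)]
[cite: Cox2013, §5.C Lemma 5.19, (5.22), §9.A] -/
theorem sqMotion_eq_kerSum_dotProduct_bits_six (hn : Squarefree n) {d : ℕ} (hd : d ∈ n.divisors) (hd8 : d % 8 = 6)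
    (hprod : 2 * ∏ j, q j = d)
    {z : APoint D.H} {Φ : Finset (D.H ≃ₐ[ℚ] D.H)} {ΓH ΓH' : Subgroup (D.H ≃ₐ[ℚ] D.H)} {σ c : D.H ≃ₐ[ℚ] D.H}
    (h : D.CMBlockSpec d z Φ ΓH ΓH' σ c) {θ : D.H ≃ₐ[ℚ] D.H} (hθd : θ (D.sqrtNeg d) = D.sqrtNeg d) (hθ : θ * θ * σ⁻¹ ∈ ΓH')
    (hodd : Odd (gK d))
    (hFrob : ∀ j : Fin m, ∃ φ : D.H ≃ₐ[ℚ] D.H, φ (D.sqrtNeg d) = D.sqrtNeg d ∧ φ * φ ∈ ΓH' ∧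
      φ D.im = (jacobiSym (-1) (q j)) • D.im ∧ φ (D.sqrtNeg 2) = (jacobiSym (-2) (q j)) • D.sqrtNeg 2 ∧
      ∀ i, i ≠ j → φ (D.sqrtNeg (q i)) = (jacobiSym (-(q i : ℤ)) (q j)) • D.sqrtNeg (q i))
    (hcard : Fintype.card {v : Fin m ⊕ Unit → ZMod 2 //
      (Matrix.fromBlocks (legendreMatrix q + legendreDiagonal q (-2)) (Matrix.of fun j (_ : Unit) => addLegendreSym 2 (q j))
        (0 : Matrix Unit (Fin m) (ZMod 2)) (0 : Matrix Unit Unit (ZMod 2))) *ᵥ v = 0} = 2)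
    (g : D.H ≃ₐ[ℚ] D.H) (hg : g (D.sqrtNeg d) = D.sqrtNeg d) :
    (if (g * g) ^ gK d * σ⁻¹ ∈ ΓH' then (1 : ZMod 2) else 0) =
      ∑ c, kerSum (Matrix.fromBlocks (legendreMatrix q + legendreDiagonal q (-2)) (Matrix.of fun j (_ : Unit) => addLegendreSym 2 (q j))
          (0 : Matrix Unit (Fin m) (ZMod 2)) (0 : Matrix Unit Unit (ZMod 2))) c *
        Sum.elim (fun i => if g (D.im * D.sqrtNeg (q i)) = D.im * D.sqrtNeg (q i) then (0 : ZMod 2) else 1)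
          (fun _ => if g (D.im * D.sqrtNeg 2) = D.im * D.sqrtNeg 2 then (0 : ZMod 2) else 1) c := by
  have hd1 : 1 < d := by omega
  have hprod' : ∏ l, (Fin.cons 2 q : Fin (m + 1) → ℕ) l = d := by rw [prod_cons_two_eq q, hprod]
  have hqn' : ∀ l, (Fin.cons 2 q : Fin (m + 1) → ℕ) l ∈ n.divisors := mem_divisors_of_block (Fin.cons 2 q) hd hprod'
  have hqn : ∀ i, q i ∈ n.divisors := fun i => by simpa only [Fin.cons_succ] using hqn' i.succ
  have h2n : 2 ∈ n.divisors := by simpa only [Fin.cons_zero] using hqn' 0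
  set N := Matrix.fromBlocks (legendreMatrix q + legendreDiagonal q (-2)) (Matrix.of fun j (_ : Unit) => addLegendreSym 2 (q j))
    (0 : Matrix Unit (Fin m) (ZMod 2)) (0 : Matrix Unit Unit (ZMod 2)) with hN
  -- the two functions on `Gal(ℍ′_n/K_d)`
  set χ : D.galK d → ZMod 2 := fun a => if ((a : D.H ≃ₐ[ℚ] D.H) * a) ^ gK d * σ⁻¹ ∈ ΓH' then 1 else 0 with hχ
  set x : D.galK d → (Fin m ⊕ Unit → ZMod 2) := fun a =>
    Sum.elim (fun i => if (a : D.H ≃ₐ[ℚ] D.H) (D.im * D.sqrtNeg (q i)) = D.im * D.sqrtNeg (q i) then (0 : ZMod 2) else 1)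
      (fun _ => if (a : D.H ≃ₐ[ℚ] D.H) (D.im * D.sqrtNeg 2) = D.im * D.sqrtNeg 2 then (0 : ZMod 2) else 1) with hx
  have hχmul : ∀ a b, χ (a * b) = χ a + χ b := fun a b => chi_mul_of_cmBlockSpec D hd hd1 h a.2 b.2
  have hxmul : ∀ a b, x (a * b) = x a + x b := by
    intro a b; funext cc
    rcases cc with i | u
    · exact bit_comp ((a : D.H ≃ₐ[ℚ] D.H) : D.H →+* D.H) ((b : D.H ≃ₐ[ℚ] D.H) : D.H →+* D.H)
        (apply_im_mul_sqrtNeg_eq_or D _ (hqn i)) (apply_im_mul_sqrtNeg_eq_or D _ (hqn i)) (im_mul_sqrtNeg_ne_zero D (hqn i))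
    · exact bit_comp ((a : D.H ≃ₐ[ℚ] D.H) : D.H →+* D.H) ((b : D.H ≃ₐ[ℚ] D.H) : D.H →+* D.H)
        (apply_im_mul_sqrtNeg_eq_or D _ h2n) (apply_im_mul_sqrtNeg_eq_or D _ h2n) (im_mul_sqrtNeg_ne_zero D h2n)
  -- (i) `χ` factors through `x`
  have hχx0 : ∀ a, x a = 0 → χ a = 0 := by
    intro a ha
    have hbits : ∀ l, (a : D.H ≃ₐ[ℚ] D.H) (D.im * D.sqrtNeg ((Fin.cons 2 q : Fin (m + 1) → ℕ) l)) =
        D.im * D.sqrtNeg ((Fin.cons 2 q : Fin (m + 1) → ℕ) l) := by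
      intro l
      refine Fin.cases ?_ (fun i => ?_) l
      · have := congr_fun ha (Sum.inr ())
        by_contra hne
        simp only [hx, Sum.elim_inr, Fin.cons_zero, Pi.zero_apply] at this hne
        rw [if_neg hne] at this; exact one_ne_zero this
      · have := congr_fun ha (Sum.inl i)
        by_contra hne
        simp only [hx, Sum.elim_inl, Fin.cons_succ, Pi.zero_apply] at this hne
        rw [if_neg hne] at this; exact one_ne_zero this
    have hL : D.TrivialOnL d a :=
      trivialOnL_of_bits_eq_zero D (Fin.cons 2 q) (prime_cons_two q hq) (injective_cons_two q hqodd hqinj) hn hd hprod' a.2 hbits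
    simp only [hχ, if_neg (chi_eq_zero_of_trivialOnL_of_cmBlockSpec D hd1 h hL)]
  have hχx : ∀ a b, x a = x b → χ a = χ b := by
    intro a b hab
    have h0 : x (a⁻¹ * b) = 0 := by
      have e := hxmul a (a⁻¹ * b)
      rw [mul_inv_cancel_left, ← hab] at e
      have : x a + x (a⁻¹ * b) = x a + 0 := by rw [add_zero]; exact e.symm
      exact add_left_cancel this
    have e := hχmul a (a⁻¹ * b)
    rw [mul_inv_cancel_left, hχx0 _ h0, add_zero] at e
    exact e.symm
  -- (iii) `x` is onto
  have hsurj : ∀ v : Fin m ⊕ Unit → ZMod 2, ∃ a : D.galK d, x a = v := by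
    intro v
    obtain ⟨a, ha, hav⟩ := exists_mem_galK_bits_eq_of_prod D (Fin.cons 2 q) (prime_cons_two q hq)
      (injective_cons_two q hqodd hqinj) hqn' hd hprod' (Fin.cons (v (Sum.inr ())) (fun i => v (Sum.inl i)))
    refine ⟨⟨a, ha⟩, funext fun cc => ?_⟩
    rcases cc with i | u
    · have := hav i.succ
      simp only [Fin.cons_succ] at this
      simpa only [hx, Sum.elim_inl] using this
    · have := hav 0
      simp only [Fin.cons_zero] at this
      simpa only [hx, Sum.elim_inr] using this
  choose lift hlift using hsurj
  have hone_triv : χ 1 = 0 := by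
    simp only [hχ]
    rw [if_neg]
    exact chi_eq_zero_of_trivialOnL_of_cmBlockSpec D hd1 h (trivialOnL_one D d)
  let δ : (Fin m ⊕ Unit → ZMod 2) →+ ZMod 2 :=
    { toFun := fun v => χ (lift v)
      map_zero' := by
        show χ (lift 0) = 0
        rw [hχx (lift 0) 1 (by
          rw [hlift]; funext cc; rcases cc with i | u
          · simp only [hx, Sum.elim_inl, Pi.zero_apply, OneMemClass.coe_one, AlgEquiv.one_apply, if_true]
          · simp only [hx, Sum.elim_inr, Pi.zero_apply, OneMemClass.coe_one, AlgEquiv.one_apply, if_true])]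
        exact hone_triv
      map_add' := fun v w => by
        show χ (lift (v + w)) = χ (lift v) + χ (lift w)
        rw [← hχmul, hχx (lift (v + w)) (lift v * lift w) (by rw [hxmul, hlift, hlift, hlift])] }
  have hδ : ∀ a, χ a = δ (x a) := fun a => hχx a (lift (x a)) (by rw [hlift])
  -- (ii) `δ` kills the rows of `N`
  have hrows : ∀ r, δ (N r) = 0 := by
    intro r
    rcases r with j | u
    · obtain ⟨φ, hφd, hφφ, hφi, hφ2, hφq⟩ := hFrob j
      have hxφ : x ⟨φ, hφd⟩ = N (Sum.inl j) :=
        funext fun cc => bits_eq_row_of_frobenius_six D q hq hqodd hqinj hd hprod j hφd hφi hφ2 hφq cc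
      rw [← hxφ, ← hδ]
      simp only [hχ]
      rw [if_neg (chi_eq_zero_of_mul_self_mem_of_cmBlockSpec D h hφφ)]
    · have hrow0 : N (Sum.inr u) = 0 := by
        funext cc; rcases cc with i | u'
        · simp only [hN, Matrix.fromBlocks_apply₂₁, Matrix.zero_apply, Pi.zero_apply]
        · simp only [hN, Matrix.fromBlocks_apply₂₂, Matrix.zero_apply, Pi.zero_apply]
      rw [hrow0, map_zero]
  -- `δ ≠ 0`: `χ(θ) = 1`
  have hχθ : χ ⟨θ, hθd⟩ = 1 := by
    simp only [hχ]
    rw [if_pos ((chi_theta_iff D h hθ).mpr hodd)]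
  -- conclude
  change χ ⟨g, hg⟩ = ∑ cc, kerSum N cc * x ⟨g, hg⟩ cc
  obtain ⟨-, hker⟩ := ker_iff_of_card_eq_two N hcard
  rcases addMonoidHom_eq_zero_or_eq_dotProduct' N hker δ hrows with hzero | hdot
  · exfalso
    rw [hδ, hzero] at hχθ
    exact zero_ne_one hχθ
  · rw [hδ, hdot, dotProduct]

/-! ## §4 The motion of `Z(d)` under a square, `d ≡ 6 (mod 8)` -/

include hq hqodd hqinj in
/-- **`g·g·Z(d) = Z(d) + (kerSum N_d · x_d(g))·τ(1)`** for `g ∈ Gal(ℍ′_n/K_d)` on a block `d ≡ 6 (mod 8)` in the genus regime (hypotheses of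
`sqMotion_eq_kerSum_dotProduct_bits_six` plus one complex conjugation for the unified block law `galPt_mul_self_Z_eq_add_ite_all`).
[cite: TianYuanZhang2017, §3.1 (p0011 L53–L64), Prop. 3.2 (2), Thm. 3.6 (2), proof of Lemma 3.21 (p0020 L50–L63)] [cite: Cox2013, §5.C, §9.A] -/
theorem galPt_mul_self_Z_eq_add_kerSum_six (hn : Squarefree n) {d : ℕ} (hd : d ∈ n.divisors) (hd8 : d % 8 = 6)
    (hprod : 2 * ∏ j, q j = d)
    {z : APoint D.H} {Φ : Finset (D.H ≃ₐ[ℚ] D.H)} {ΓH ΓH' : Subgroup (D.H ≃ₐ[ℚ] D.H)} {σ c : D.H ≃ₐ[ℚ] D.H}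
    (h : D.CMBlockSpec d z Φ ΓH ΓH' σ c) (hc : D.ConjSpec c) {θ : D.H ≃ₐ[ℚ] D.H} (hθd : θ (D.sqrtNeg d) = D.sqrtNeg d)
    (hθ : θ * θ * σ⁻¹ ∈ ΓH') (hodd : Odd (gK d))
    (hFrob : ∀ j : Fin m, ∃ φ : D.H ≃ₐ[ℚ] D.H, φ (D.sqrtNeg d) = D.sqrtNeg d ∧ φ * φ ∈ ΓH' ∧
      φ D.im = (jacobiSym (-1) (q j)) • D.im ∧ φ (D.sqrtNeg 2) = (jacobiSym (-2) (q j)) • D.sqrtNeg 2 ∧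
      ∀ i, i ≠ j → φ (D.sqrtNeg (q i)) = (jacobiSym (-(q i : ℤ)) (q j)) • D.sqrtNeg (q i))
    (hcard : Fintype.card {v : Fin m ⊕ Unit → ZMod 2 //
      (Matrix.fromBlocks (legendreMatrix q + legendreDiagonal q (-2)) (Matrix.of fun j (_ : Unit) => addLegendreSym 2 (q j))
        (0 : Matrix Unit (Fin m) (ZMod 2)) (0 : Matrix Unit Unit (ZMod 2))) *ᵥ v = 0} = 2)
    (g : D.H ≃ₐ[ℚ] D.H) (hg : g (D.sqrtNeg d) = D.sqrtNeg d) :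
    D.galPt (g * g) (D.Z d) = D.Z d +
      (∑ c, kerSum (Matrix.fromBlocks (legendreMatrix q + legendreDiagonal q (-2)) (Matrix.of fun j (_ : Unit) => addLegendreSym 2 (q j))
          (0 : Matrix Unit (Fin m) (ZMod 2)) (0 : Matrix Unit Unit (ZMod 2))) c *
        Sum.elim (fun i => if g (D.im * D.sqrtNeg (q i)) = D.im * D.sqrtNeg (q i) then (0 : ZMod 2) else 1)
          (fun _ => if g (D.im * D.sqrtNeg 2) = D.im * D.sqrtNeg 2 then (0 : ZMod 2) else 1) c).val • (tauOne : APoint D.H) := by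
  have hd1 : 1 < d := by omega
  rw [galPt_mul_self_Z_eq_add_ite_all D hd hd1 h hc g,
    ← sqMotion_eq_kerSum_dotProduct_bits_six D q hq hqodd hqinj hn hd hd8 hprod h hθd hθ hodd hFrob hcard g hg]
  by_cases hm : (g * g) ^ gK d * σ⁻¹ ∈ ΓH'
  · rw [if_pos ⟨hg, hm⟩, if_pos hm, ZMod.val_one]
  · rw [if_neg (fun hh => hm hh.2), if_neg hm, ZMod.val_zero]

end Summit.BirchSwinnertonDyer.PrintCf2.MoverAssembly

end
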